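import Mathlib
import Summits.Ventures.PercRepro2.HCov
import Summits.Ventures.PercRepro2.HCovSwap
import Summits.Ventures.PercRepro2.ContractDefs

/-!
# The root-edge contraction reduction of (HCOV) (blind cell PercRepro2, p1 g10;
MINE2-RECM.md §2′ and MINE2-HUB.md §4, weighted form)

**(RECM) at a root edge.** For a root edge `e = {a₁, y}` whose other end `y` is UNMARKED,
`G/e` is the graph in which `y` is merged into the root `a₁` — here `Contract.contractEnds ends {a₁, y} a₁`
on the same vertex and edge types (`e` and every edge parallel to it become loops at `a₁` and `y`
becomes isolated; neither is seen by any connection event, so `Gc` of this graph is `Gc(G/e)` of the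
multigraph `G/e`, independent of the weight of the loop `e`). The local inequality is

  `RECMAt`: `p_e · Gc(G/e) ≤ Gc(G)`   (row (RECM-UY) / 2′CW-RECM in its weighted form).

**Class R** (`RootsToMarks`): every edge at a root has both ends among the five marks (loops included —
a loop at a root has both ends equal to that root). On this class (HCOV) is the hub theorem of
MINE2-HUB.md (computer-assisted; here a hypothesis `HCovR_all`).

**THE REDUCTION** (`HCov_all_of_RECM_all`): `RECM_all ∧ HCovR_all → HCov_all`, by strong induction on
the number of non-loop edges `nonLoopCard ends`: if some root edge reaches an unmarked vertex,
contract it — `Gc(G) ≥ p_e · Gc(G/e) ≥ 0` by (RECM) and the induction hypothesis (the contraction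
turns `e` into a loop, so `nonLoopCard` drops, `nonLoopCard_contract_lt`); an edge at the second root
is handled through the root symmetry `Gc_swap`; otherwise the graph is in class R. So a minimal
counterexample to (HCOV) has both roots adjacent only to marks — exactly MINE2-RECM.md §2′ / MINE2-HUB.md §4.
-/

namespace Summit.Ventures.PercRepro2

open CovForm Contract

namespace RECM

section Defs

variable {V : Type*} {E : Type*} [Fintype E] [DecidableEq E] [DecidableEq V] {R : Type*}
  [Field R] [LinearOrder R]

/-- **`G/e` at a root edge `e = {a₁, y}`**: `y` merged into the root `a₁`
(`Contract.contractEnds ends {a₁, y} a₁`; `e` becomes a loop at `a₁`, `y` becomes isolated). -/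
abbrev contractRootEdge (ends : E → Sym2 V) (a₁ y : V) : E → Sym2 V :=
  contractEnds ends {a₁, y} a₁

/-- **(RECM) at the root edge `e = {a₁, y}`**: `p_e · Gc(G/e) ≤ Gc(G)` (weighted root-edge
contraction monotonicity; the multigraph `G/e` is read as `contractRootEdge ends a₁ y`). -/
def RECMAt (p : E → R) (ends : E → Sym2 V) (o a₁ a₂ a₃ b : V) (e : E) (y : V) : Prop :=
  p e * Gc p (contractRootEdge ends a₁ y) o a₁ a₂ a₃ b ≤ Gc p ends o a₁ a₂ a₃ b

/-- `y` is **unmarked**: none of the five marks `o, a₁, a₂, a₃, b`. -/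
def Unmarked (o a₁ a₂ a₃ b y : V) : Prop :=
  y ≠ o ∧ y ≠ a₁ ∧ y ≠ a₂ ∧ y ≠ a₃ ∧ y ≠ b

/-- **Class R** (MINE2-RECM.md §2′): every edge at a root has both of its ends among the marks
(«both roots adjacent only to marked vertices»; loops at a root qualify trivially). -/
def RootsToMarks (ends : E → Sym2 V) (o a₁ a₂ a₃ b : V) : Prop :=
  ∀ e, (a₁ ∈ ends e ∨ a₂ ∈ ends e) → ∀ z ∈ ends e, z = o ∨ z = a₁ ∨ z = a₂ ∨ z = a₃ ∨ z = b

/-- The number of non-loop edges of `ends` (the induction measure: contraction turns the contracted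
root edge into a loop). -/
def nonLoopCard (ends : E → Sym2 V) : ℕ :=
  (Finset.univ.filter fun e => ¬ (ends e).IsDiag).card

end Defs

section Closure

variable (R : Type*) [Field R] [LinearOrder R] [IsStrictOrderedRing R]

/-- **Row (RECM-UY)**: (RECM) at every root edge `e = {a₁, y}` with `y` unmarked, on every finite
graph with distinct marks and admissible weights (the one local inequality left open by the
root-edge reduction; census 0 / 5 × 273,888 at n = 6 FULL, 0 / 1,475,040 at n = 7, m ≤ 12, p1 g10
own exact code, besides mine-2's). -/
def RECM_all : Prop :=
  ∀ (V E : Type) [Fintype V] [DecidableEq V] [Fintype E] [DecidableEq E]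
    (ends : E → Sym2 V) (p : E → R), IsProbVec p →
    ∀ o a₁ a₂ a₃ b : V, a₁ ≠ a₂ → a₁ ≠ a₃ → a₂ ≠ a₃ → o ≠ a₁ → o ≠ a₂ → o ≠ a₃ → o ≠ b →
      b ≠ a₁ → b ≠ a₂ → b ≠ a₃ → ∀ (y : V) (e : E), Unmarked o a₁ a₂ a₃ b y → ends e = s(a₁, y) →
        RECMAt p ends o a₁ a₂ a₃ b e y

/-- **(HCOV) on class R** (the hub theorem of MINE2-HUB.md, as a hypothesis): (HCOV) for every finite
graph with distinct marks and admissible weights in which every edge at a root ends in a mark. -/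
def HCovR_all : Prop :=
  ∀ (V E : Type) [Fintype V] [DecidableEq V] [Fintype E] [DecidableEq E]
    (ends : E → Sym2 V) (p : E → R), IsProbVec p →
    ∀ o a₁ a₂ a₃ b : V, a₁ ≠ a₂ → a₁ ≠ a₃ → a₂ ≠ a₃ → o ≠ a₁ → o ≠ a₂ → o ≠ a₃ → o ≠ b →
      b ≠ a₁ → b ≠ a₂ → b ≠ a₃ → RootsToMarks ends o a₁ a₂ a₃ b → HCov p ends o a₁ a₂ a₃ b

end Closure

section Count

variable {V : Type*} {E : Type*} [Fintype E] [DecidableEq E] [DecidableEq V]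

/-- The image of a loop under a vertex map is a loop. -/
lemma isDiag_map_of_isDiag {α β : Type*} (g : α → β) (z : Sym2 α) (h : z.IsDiag) :
    (z.map g).IsDiag := by
  revert h
  refine Sym2.inductionOn z fun x y h => ?_
  rw [Sym2.mk_isDiag_iff] at h
  rw [Sym2.map_mk, Sym2.mk_isDiag_iff, h]

omit [Fintype E] [DecidableEq E] in
/-- A loop of `G` is a loop of `G/W`. -/
lemma isDiag_contract_of_isDiag (ends : E → Sym2 V) (W : Finset V) (w₀ : V) {f : E}
    (h : (ends f).IsDiag) : (contractEnds ends W w₀ f).IsDiag := by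
  rw [contractEnds_apply]
  exact isDiag_map_of_isDiag _ _ h

omit [DecidableEq E] in
/-- **Contracting a non-loop root edge `e = {a₁, y}` lowers the number of non-loop edges**: every loop
stays a loop and `e` itself becomes one. -/
lemma nonLoopCard_contract_lt (ends : E → Sym2 V) {a₁ y : V} (hne : a₁ ≠ y) {e : E}
    (he : ends e = s(a₁, y)) :
    nonLoopCard (contractRootEdge ends a₁ y) < nonLoopCard ends := by
  unfold nonLoopCard
  apply Finset.card_lt_card
  have hsub : (Finset.univ.filter fun f => ¬ (contractRootEdge ends a₁ y f).IsDiag) ⊆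
      Finset.univ.filter fun f => ¬ (ends f).IsDiag := by
    intro f hf
    simp only [Finset.mem_filter, Finset.mem_univ, true_and] at hf ⊢
    exact fun hd => hf (isDiag_contract_of_isDiag ends _ _ hd)
  rw [Finset.ssubset_iff_of_subset hsub]
  refine ⟨e, ?_, ?_⟩
  · simp only [Finset.mem_filter, Finset.mem_univ, true_and]
    rw [he, Sym2.mk_isDiag_iff]
    exact hne
  · simp only [Finset.mem_filter, Finset.mem_univ, true_and, not_not]
    rw [contractRootEdge, contractEnds_apply, he, Sym2.map_mk, Sym2.mk_isDiag_iff,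
      contractMap_of_mem (Finset.mem_insert_self a₁ {y}),
      contractMap_of_mem (Finset.mem_insert_of_mem (Finset.mem_singleton_self y))]

end Count

section Main

variable {R : Type*} [Field R] [LinearOrder R] [IsStrictOrderedRing R]

/-- **The reduction, by strong induction on the number of non-loop edges**: (HCOV) for every graph
on the types `V, E` from (RECM) at unmarked-`y` root edges and (HCOV) on class R. -/
theorem HCov_of_RECM_of_base {V E : Type} [Fintype V] [DecidableEq V] [Fintype E] [DecidableEq E]
    (hR : RECM_all R) (hB : HCovR_all R) (n : ℕ) :
    ∀ (ends : E → Sym2 V), nonLoopCard ends = n → ∀ (p : E → R), IsProbVec p →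
      ∀ o a₁ a₂ a₃ b : V, a₁ ≠ a₂ → a₁ ≠ a₃ → a₂ ≠ a₃ → o ≠ a₁ → o ≠ a₂ → o ≠ a₃ → o ≠ b →
        b ≠ a₁ → b ≠ a₂ → b ≠ a₃ → HCov p ends o a₁ a₂ a₃ b := by
  induction n using Nat.strong_induction_on with
  | _ n ih =>
  intro ends hn p hp o a₁ a₂ a₃ b h12 h13 h23 ho1 ho2 ho3 hob hb1 hb2 hb3
  by_cases h1 : ∃ (e : E) (y : V), Unmarked o a₁ a₂ a₃ b y ∧ ends e = s(a₁, y)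
  · -- a root edge at `a₁` reaches an unmarked vertex: contract it
    obtain ⟨e, y, hy, he⟩ := h1
    have hrecm := hR V E ends p hp o a₁ a₂ a₃ b h12 h13 h23 ho1 ho2 ho3 hob hb1 hb2 hb3 y e hy he
    have hlt : nonLoopCard (contractRootEdge ends a₁ y) < n :=
      hn ▸ nonLoopCard_contract_lt ends hy.2.1.symm he
    have hIH := ih _ hlt (contractRootEdge ends a₁ y) rfl p hp o a₁ a₂ a₃ b h12 h13 h23 ho1 ho2
      ho3 hob hb1 hb2 hb3
    unfold HCov at hIH ⊢
    unfold RECMAt at hrecm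
    exact le_trans (mul_nonneg (hp.nonneg e) hIH) hrecm
  · by_cases h2 : ∃ (e : E) (y : V), Unmarked o a₁ a₂ a₃ b y ∧ ends e = s(a₂, y)
    · -- a root edge at `a₂` reaches an unmarked vertex: swap the roots and contract it
      obtain ⟨e, y, hy, he⟩ := h2
      have hy' : Unmarked o a₂ a₁ a₃ b y := ⟨hy.1, hy.2.2.1, hy.2.1, hy.2.2.2.1, hy.2.2.2.2⟩
      have hrecm := hR V E ends p hp o a₂ a₁ a₃ b h12.symm h23 h13 ho2 ho1 ho3 hob hb2 hb1 hb3 y e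
        hy' he
      have hlt : nonLoopCard (contractRootEdge ends a₂ y) < n :=
        hn ▸ nonLoopCard_contract_lt ends hy.2.2.1.symm he
      have hIH := ih _ hlt (contractRootEdge ends a₂ y) rfl p hp o a₁ a₂ a₃ b h12 h13 h23 ho1 ho2
        ho3 hob hb1 hb2 hb3
      unfold HCov at hIH ⊢
      unfold RECMAt at hrecm
      rw [Gc_swap p (contractRootEdge ends a₂ y) o a₁ a₂ a₃ b, Gc_swap p ends o a₁ a₂ a₃ b] at hrecm
      exact le_trans (mul_nonneg (hp.nonneg e) hIH) hrecm
    · -- both roots are adjacent only to marks: class R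
      apply hB V E ends p hp o a₁ a₂ a₃ b h12 h13 h23 ho1 ho2 ho3 hob hb1 hb2 hb3
      intro f hroot z hz
      rcases hroot with hf | hf
      · obtain ⟨y, hy⟩ := Sym2.mem_iff_exists.mp hf
        rw [hy] at hz
        rcases Sym2.mem_iff.mp hz with hz1 | hz2
        · rw [hz1]
          simp
        · rw [hz2]
          by_contra hzm
          push Not at hzm
          exact h1 ⟨f, y, hzm, hy⟩
      · obtain ⟨y, hy⟩ := Sym2.mem_iff_exists.mp hf
        rw [hy] at hz
        rcases Sym2.mem_iff.mp hz with hz1 | hz2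
        · rw [hz1]
          simp
        · rw [hz2]
          by_contra hzm
          push Not at hzm
          exact h2 ⟨f, y, hzm, hy⟩

/-- **THE ROOT-EDGE REDUCTION OF (HCOV)**: `RECM_all ∧ HCovR_all → HCov_all` — (HCOV) for every
finite weighted graph follows from (RECM) at root edges with an unmarked other end together with
(HCOV) on class R (MINE2-RECM.md §2′, MINE2-HUB.md §4; the weighted form). -/
theorem HCov_all_of_RECM_all (hR : RECM_all R) (hB : HCovR_all R) : HCov_all R := by
  intro V E _ _ _ _ ends p hp o a₁ a₂ a₃ b h12 h13 h23 ho1 ho2 ho3 hob hb1 hb2 hb3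
  exact HCov_of_RECM_of_base hR hB _ ends rfl p hp o a₁ a₂ a₃ b h12 h13 h23 ho1 ho2 ho3 hob hb1
    hb2 hb3

end Main

end RECM

end Summit.Ventures.PercRepro2
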